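import Literature.NumberTheory.Sieve.ShiuTheoremProofs
import HarnessLib

/-!
# Local Euler-product bookkeeping for the bivariate Brun–Titchmarsh bound

Topic `Literature/NumberTheory/Sieve`. Everything here is PROVED; no definition is introduced.
Tools for the `h`-part of the sums `∑_{c₁, c₂} f(c₁) g(c₂) (c₁, c₂)/(c₁c₂)` that arise in the
Shiu–Nair–Tenenbaum treatment of `∑_{n ≤ X} f(n) g(mn + h)` (Matomäki–Merikoski,
arXiv:2112.11412, Lemma 3.1; Henriot's `Δ_D`):

* `PairShiuLocal.sum_le_prod_sum_of_injOn` — the two-variable Euler-product majorant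
  `∑_{(e₁,e₂)} ∏_p λ_p(Φ(e)_p) ≤ ∏_p ∑_j λ_p(j)` for an injective "local type" map `Φ`;
* `PairShiuLocal.local_sum_le` — the local sums at a prime `p ∣ h` under the coupling
  `v_p(e₁) = 0 ↔ v_p(e₂) = 0`: `≤ 1 + F₁(p)F₂(p)/p + 60 Â²/(p√p)`;
* `PairShiuLocal.sum_pairs_le` — the resulting bound
  `∑_{(e₁,e₂)} F₁(e₁)F₂(e₂)(e₁,e₂)/(e₁e₂) ≤ e^{120 Â²} ∏_{p ∣ h} (1 + F₁(p)F₂(p)/p)`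
  over any family of `h`-supported pairs with `rad e₁ = rad e₂`;
* the correction factor `ψ(k) = ∏_{p ∣ k, p ≠ 2} (p−1)/(p−2)` of the odd sifting density
  (`one_le_psi`, `psi_mul_le`, `prod_filter_dvd_le_psi`).

## References

* K. Matomäki, J. Merikoski, IMRN 2023 (arXiv:2112.11412), Lemma 3.1 and its proof (the factor
  `Δ_D`). [cite: MatomakiMerikoski2023, Lemma 3.1]
* P. Shiu, J. reine angew. Math. 313 (1980), 161–170, §2. [cite: Shiu1980, §2]
-/

noncomputable section

open Finset Real

namespace Literature.NumberTheory.Sieve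

namespace PairShiuLocal

/-! ### The two-variable Euler-product majorant -/

/-- **Two-variable Euler-product majorant.** If every `e ∈ Pairs` has a "local type"
`Φ e p ∈ J` at each `p ∈ s`, the type map is injective on `Pairs`, the local weights are
non-negative and `W(e) = ∏_{p ∈ s} λ_p(Φ e p)`, then `∑_{e ∈ Pairs} W(e) ≤ ∏_{p ∈ s} ∑_{j ∈ J} λ_p(j)`.
[folklore] -/
theorem sum_le_prod_sum_of_injOn {ι κ : Type*} [DecidableEq ι] [DecidableEq κ]
    (s : Finset ℕ) (J : Finset κ) (lam : ℕ → κ → ℝ)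
    (hlam : ∀ p ∈ s, ∀ j ∈ J, 0 ≤ lam p j) (Pairs : Finset ι) (Φ : ι → ℕ → κ)
    (hΦJ : ∀ e ∈ Pairs, ∀ p ∈ s, Φ e p ∈ J)
    (hinj : Set.InjOn (fun e => fun (p : ℕ) (_ : p ∈ s) => Φ e p) Pairs)
    (W : ι → ℝ) (hW : ∀ e ∈ Pairs, W e = ∏ p ∈ s, lam p (Φ e p)) :
    ∑ e ∈ Pairs, W e ≤ ∏ p ∈ s, ∑ j ∈ J, lam p j := by
  classical
  rw [Finset.prod_sum s (fun _ => J) (fun p j => lam p j)]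
  set Ψ : ι → ((p : ℕ) → p ∈ s → κ) := fun e => fun p _ => Φ e p with hΨ
  have hsum : ∑ e ∈ Pairs, W e =
      ∑ ψ ∈ Pairs.image Ψ, ∏ x ∈ s.attach, lam x (ψ x x.2) := by
    rw [Finset.sum_image (fun e₁ he₁ e₂ he₂ h => hinj he₁ he₂ h)]
    refine Finset.sum_congr rfl fun e he => ?_
    rw [hW e he, ← Finset.prod_attach s (f := fun p => lam p (Φ e p))]
  rw [hsum]
  refine Finset.sum_le_sum_of_subset_of_nonneg ?_ ?_
  · intro ψ hψ
    rw [Finset.mem_image] at hψ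
    obtain ⟨e, he, rfl⟩ := hψ
    rw [Finset.mem_pi]
    intro p hp
    exact hΦJ e he p hp
  · intro ψ hψ _
    rw [Finset.mem_pi] at hψ
    exact Finset.prod_nonneg fun x _ => hlam x x.2 _ (hψ x x.2)

/-! ### Numerical lemmas -/

/-- `∑_{n ∈ S} 1/(n√n) ≤ 2` for any finite set of integers `n ≥ 2`
(telescoping `1/(n√n) ≤ 2/√(n−1) − 2/√n`). [folklore] -/
theorem sum_inv_mul_sqrt_le_two (S : Finset ℕ) (hS : ∀ n ∈ S, 2 ≤ n) :
    ∑ n ∈ S, 1 / ((n : ℝ) * Real.sqrt n) ≤ 2 := by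
  -- compare with the telescoping sum over `Icc 2 M`
  have hpt : ∀ n : ℕ, 2 ≤ n →
      1 / ((n : ℝ) * Real.sqrt n) ≤ 2 / Real.sqrt ((n : ℝ) - 1) - 2 / Real.sqrt n := by
    intro n hn
    have hn' : (2 : ℝ) ≤ n := by exact_mod_cast hn
    have h1 : 0 < Real.sqrt ((n : ℝ) - 1) := Real.sqrt_pos.mpr (by linarith)
    have h2 : 0 < Real.sqrt (n : ℝ) := Real.sqrt_pos.mpr (by linarith)
    have h12 : Real.sqrt ((n : ℝ) - 1) ≤ Real.sqrt n := Real.sqrt_le_sqrt (by linarith)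
    have hsq1 : Real.sqrt ((n : ℝ) - 1) ^ 2 = n - 1 := Real.sq_sqrt (by linarith)
    have hsq2 : Real.sqrt (n : ℝ) ^ 2 = n := Real.sq_sqrt (by linarith)
    rw [div_sub_div _ _ h1.ne' h2.ne', div_le_div_iff₀ (by positivity) (by positivity)]
    -- `√(n-1) √n ≤ (2√n − 2√(n−1)) · n √n`, i.e. `√(n-1) ≤ 2n(√n − √(n−1))`
    have key : Real.sqrt ((n : ℝ) - 1) ≤ 2 * n * (Real.sqrt n - Real.sqrt ((n : ℝ) - 1)) := by
      -- `(√n − √(n−1))(√n + √(n−1)) = 1`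
      have hprod : (Real.sqrt (n : ℝ) - Real.sqrt ((n : ℝ) - 1)) *
          (Real.sqrt n + Real.sqrt ((n : ℝ) - 1)) = 1 := by nlinarith
      have hpos : 0 < Real.sqrt (n : ℝ) + Real.sqrt ((n : ℝ) - 1) := by positivity
      have hdiff : Real.sqrt (n : ℝ) - Real.sqrt ((n : ℝ) - 1) =
          1 / (Real.sqrt n + Real.sqrt ((n : ℝ) - 1)) := by
        field_simp
        linarith [hprod]
      rw [hdiff, mul_one_div, le_div_iff₀ hpos]
      nlinarith [h12, hsq2]
    nlinarith [key, h1, h2]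
  rcases S.eq_empty_or_nonempty with rfl | hne
  · simp
  set M := S.max' hne with hM
  have hsub : S ⊆ Icc 2 M := fun n hn => Finset.mem_Icc.mpr ⟨hS n hn, Finset.le_max' S n hn⟩
  calc ∑ n ∈ S, 1 / ((n : ℝ) * Real.sqrt n)
      ≤ ∑ n ∈ Icc 2 M, 1 / ((n : ℝ) * Real.sqrt n) :=
        Finset.sum_le_sum_of_subset_of_nonneg hsub fun n _ _ => by positivity
    _ ≤ ∑ n ∈ Icc 2 M, (2 / Real.sqrt ((n : ℝ) - 1) - 2 / Real.sqrt n) :=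
        Finset.sum_le_sum fun n hn => hpt n (Finset.mem_Icc.mp hn).1
    _ ≤ 2 := by
        -- telescoping
        have htel : ∀ K : ℕ, ∑ n ∈ Icc 2 (K + 1), (2 / Real.sqrt ((n : ℝ) - 1) - 2 / Real.sqrt n)
            = 2 - 2 / Real.sqrt ((K + 1 : ℕ) : ℝ) := by
          intro K
          induction K with
          | zero =>
            simp
          | succ K ih =>
            rw [Finset.sum_Icc_succ_top (by omega), ih]
            push_cast
            ring
        rcases Nat.exists_eq_succ_of_ne_zero (show M ≠ 0 by
          have := hS _ (Finset.max'_mem S hne); omega) with ⟨K, hK⟩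
        rw [hK, htel K]
        have : 0 ≤ 2 / Real.sqrt ((K + 1 : ℕ) : ℝ) := by positivity
        linarith


/-- `j + 3 ≤ 3 (3/2)^j` (Bernoulli). [folklore] -/
theorem add_three_le (j : ℕ) : (j : ℝ) + 3 ≤ 3 * (3 / 2 : ℝ) ^ j := by
  have h := one_add_mul_le_pow (show (-2 : ℝ) ≤ 1 / 2 by norm_num) j
  have : (1 + 1 / 2 : ℝ) = 3 / 2 := by norm_num
  rw [this] at h
  linarith

/-- `∑_{2 ≤ a ≤ A} (a+1) ρ^a ≤ 38 ρ²` for `0 ≤ ρ ≤ 3/5`. [folklore] -/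
theorem weighted_geom_sum_le {ρ : ℝ} (hρ0 : 0 ≤ ρ) (hρ : ρ ≤ 3 / 5) (A : ℕ) :
    ∑ a ∈ range (A + 1), (if 2 ≤ a then ((a : ℝ) + 1) * ρ ^ a else 0) ≤ 38 * ρ ^ 2 := by
  -- termwise: `[2 ≤ a] (a+1) ρ^a ≤ (100/27) ρ² (9/10)^a`
  have hpt : ∀ a : ℕ, (if 2 ≤ a then ((a : ℝ) + 1) * ρ ^ a else 0) ≤
      (100 / 27) * ρ ^ 2 * (9 / 10 : ℝ) ^ a := by
    intro a
    split_ifs with ha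
    · obtain ⟨j, rfl⟩ : ∃ j, a = j + 2 := ⟨a - 2, by omega⟩
      have hj := add_three_le j
      push_cast
      have hρj : ρ ^ j ≤ (3 / 5 : ℝ) ^ j := pow_le_pow_left₀ hρ0 hρ j
      have h35 : (0 : ℝ) ≤ (3 / 5 : ℝ) ^ j := by positivity
      calc ((j : ℝ) + 2 + 1) * ρ ^ (j + 2) = ((j : ℝ) + 3) * ρ ^ j * ρ ^ 2 := by ring
        _ ≤ (3 * (3 / 2 : ℝ) ^ j) * (3 / 5 : ℝ) ^ j * ρ ^ 2 := by
            gcongr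
        _ = 3 * ((3 / 2 : ℝ) * (3 / 5)) ^ j * ρ ^ 2 := by rw [mul_pow]; ring
        _ = (100 / 27) * ρ ^ 2 * (9 / 10 : ℝ) ^ (j + 2) := by
            rw [pow_add]; norm_num; ring
    · positivity
  have hgeom : ∑ a ∈ range (A + 1), (9 / 10 : ℝ) ^ a ≤ 10 := by
    rw [geom_sum_eq (by norm_num)]
    have : (0 : ℝ) < (9 / 10 : ℝ) ^ (A + 1) := by positivity
    have h2 : ((9 / 10 : ℝ) ^ (A + 1) - 1) / ((9 / 10 : ℝ) - 1) = 10 * (1 - (9 / 10 : ℝ) ^ (A + 1)) := by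
      field_simp
      ring
    rw [h2]
    linarith
  calc ∑ a ∈ range (A + 1), (if 2 ≤ a then ((a : ℝ) + 1) * ρ ^ a else 0)
      ≤ ∑ a ∈ range (A + 1), (100 / 27) * ρ ^ 2 * (9 / 10 : ℝ) ^ a := Finset.sum_le_sum fun a _ => hpt a
    _ = (100 / 27) * ρ ^ 2 * ∑ a ∈ range (A + 1), (9 / 10 : ℝ) ^ a := by rw [Finset.mul_sum]
    _ ≤ (100 / 27) * ρ ^ 2 * 10 := by gcongr
    _ ≤ 38 * ρ ^ 2 := by nlinarith [sq_nonneg ρ]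

/-- The Rankin-type weight `ρ = p^{-3/4}` at a prime: `0 < ρ ≤ 3/5` and `ρ² = 1/(p√p)`. [folklore] -/
theorem rho_facts {p : ℕ} (hp : p.Prime) :
    0 < (p : ℝ) ^ (-(3 / 4 : ℝ)) ∧ (p : ℝ) ^ (-(3 / 4 : ℝ)) ≤ 3 / 5 ∧
      ((p : ℝ) ^ (-(3 / 4 : ℝ))) ^ 2 = 1 / ((p : ℝ) * Real.sqrt p) := by
  have hp2 : (2 : ℝ) ≤ p := by exact_mod_cast hp.two_le
  have hp0 : (0 : ℝ) < p := by linarith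
  refine ⟨Real.rpow_pos_of_pos hp0 _, ?_, ?_⟩
  · -- `p^{-3/4} ≤ 2^{-3/4} ≤ 3/5` since `(3/5)^4 ≥ 1/8`
    have h1 : (p : ℝ) ^ (-(3 / 4 : ℝ)) ≤ (2 : ℝ) ^ (-(3 / 4 : ℝ)) :=
      Real.rpow_le_rpow_of_nonpos (by norm_num) hp2 (by norm_num)
    refine h1.trans ?_
    have h2 : ((2 : ℝ) ^ (-(3 / 4 : ℝ))) ^ (4 : ℕ) = 1 / 8 := by
      rw [← Real.rpow_natCast, ← Real.rpow_mul (by norm_num),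
        show (-(3 / 4 : ℝ)) * ((4 : ℕ) : ℝ) = -(3 : ℕ) by norm_num, Real.rpow_neg (by norm_num),
        Real.rpow_natCast]
      norm_num
    have h3 : (0 : ℝ) ≤ (2 : ℝ) ^ (-(3 / 4 : ℝ)) := by positivity
    by_contra hlt
    push Not at hlt
    have : (3 / 5 : ℝ) ^ (4 : ℕ) < ((2 : ℝ) ^ (-(3 / 4 : ℝ))) ^ (4 : ℕ) :=
      pow_lt_pow_left₀ hlt (by norm_num) (by norm_num)
    rw [h2] at this
    norm_num at this
  · rw [← Real.rpow_natCast, ← Real.rpow_mul hp0.le]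
    have : (p : ℝ) * Real.sqrt p = (p : ℝ) ^ (3 / 2 : ℝ) := by
      rw [Real.sqrt_eq_rpow, show (3 / 2 : ℝ) = 1 + 1 / 2 by norm_num, Real.rpow_add hp0,
        Real.rpow_one]
    rw [this, show (-(3 / 4 : ℝ)) * ((2 : ℕ) : ℝ) = -(3 / 2 : ℝ) by norm_num, Real.rpow_neg hp0.le,
      one_div]


/-! ### Local sums at a prime dividing `h` -/

/-- **Pointwise bound for the local weights.** For `F₁, F₂ ≥ 0` with `Fᵢ(1) = 1` and
`Fᵢ(p^a) ≤ Â (p^a)^{1/8}`, the coupled local weight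
`λ(a,b) = [a = 0 ↔ b = 0] F₁(p^a)F₂(p^b) p^{min(a,b)}/(p^a p^b)` is at most
`[a=b=0] + [a=b=1] F₁(p)F₂(p)/p + Â² ([2 ≤ a, b ≤ a] ρ^a + [2 ≤ b, a ≤ b] ρ^b)`, `ρ = p^{-3/4}`.
[cite: MatomakiMerikoski2023, Lemma 3.1 (the factor Δ_D)] -/
theorem local_term_le {F₁ F₂ : ℕ → ℝ} (h0₁ : ∀ n, 0 ≤ F₁ n) (h0₂ : ∀ n, 0 ≤ F₂ n)
    (h1₁ : F₁ 1 = 1) (h1₂ : F₂ 1 = 1) {Â : ℝ} (hÂ : 0 ≤ Â) {p : ℕ} (hp : p.Prime)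
    (hb₁ : ∀ a : ℕ, 1 ≤ a → F₁ (p ^ a) ≤ Â * ((p : ℝ) ^ a) ^ (1 / 8 : ℝ))
    (hb₂ : ∀ a : ℕ, 1 ≤ a → F₂ (p ^ a) ≤ Â * ((p : ℝ) ^ a) ^ (1 / 8 : ℝ)) (a b : ℕ) :
    (if (a = 0 ↔ b = 0) then
        F₁ (p ^ a) * F₂ (p ^ b) * (p : ℝ) ^ (min a b) / ((p : ℝ) ^ a * (p : ℝ) ^ b) else 0) ≤
      (if a = 0 ∧ b = 0 then (1 : ℝ) else 0) + (if a = 1 ∧ b = 1 then F₁ p * F₂ p / p else 0) +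
        Â ^ 2 * ((if 2 ≤ a ∧ b ≤ a then ((p : ℝ) ^ (-(3 / 4 : ℝ))) ^ a else 0) +
          (if 2 ≤ b ∧ a ≤ b then ((p : ℝ) ^ (-(3 / 4 : ℝ))) ^ b else 0)) := by
  obtain ⟨hρ0, -, -⟩ := rho_facts hp
  set ρ : ℝ := (p : ℝ) ^ (-(3 / 4 : ℝ)) with hρ
  have hp1 : (1 : ℝ) ≤ p := by exact_mod_cast hp.one_lt.le
  have hp0 : (0 : ℝ) < p := by linarith
  have hc0 : 0 ≤ F₁ p * F₂ p / p := by have := h0₁ p; have := h0₂ p; positivity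
  -- nonnegativity of the right-hand side pieces
  have hR1 : 0 ≤ (if a = 0 ∧ b = 0 then (1 : ℝ) else 0) := by split_ifs <;> norm_num
  have hR2 : 0 ≤ (if a = 1 ∧ b = 1 then F₁ p * F₂ p / p else 0) := by
    split_ifs
    · exact hc0
    · norm_num
  have hR3 : 0 ≤ (if 2 ≤ a ∧ b ≤ a then ρ ^ a else 0) := by
    split_ifs
    · positivity
    · norm_num
  have hR4 : 0 ≤ (if 2 ≤ b ∧ a ≤ b then ρ ^ b else 0) := by
    split_ifs
    · positivity
    · norm_num
  -- the key estimate in the range `max(a,b) ≥ 2`, `b ≤ a`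
  have key : ∀ {G₁ G₂ : ℕ → ℝ}, (∀ n, 0 ≤ G₁ n) → (∀ n, 0 ≤ G₂ n) →
      (∀ a : ℕ, 1 ≤ a → G₁ (p ^ a) ≤ Â * ((p : ℝ) ^ a) ^ (1 / 8 : ℝ)) →
      (∀ a : ℕ, 1 ≤ a → G₂ (p ^ a) ≤ Â * ((p : ℝ) ^ a) ^ (1 / 8 : ℝ)) →
      ∀ a b : ℕ, 1 ≤ b → b ≤ a →
        G₁ (p ^ a) * G₂ (p ^ b) * (p : ℝ) ^ (min a b) / ((p : ℝ) ^ a * (p : ℝ) ^ b) ≤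
          Â ^ 2 * ρ ^ a := by
    intro G₁ G₂ hG₁ hG₂ hbG₁ hbG₂ a b hb hba
    have ha : 1 ≤ a := hb.trans hba
    have hpa : (0 : ℝ) < (p : ℝ) ^ a := by positivity
    have hpb : (0 : ℝ) < (p : ℝ) ^ b := by positivity
    rw [min_eq_right hba]
    have hsimp : G₁ (p ^ a) * G₂ (p ^ b) * (p : ℝ) ^ b / ((p : ℝ) ^ a * (p : ℝ) ^ b) =
        G₁ (p ^ a) * G₂ (p ^ b) / (p : ℝ) ^ a := by
      field_simp
    rw [hsimp, div_le_iff₀ hpa]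
    have h1 := hbG₁ a ha
    have h2 : G₂ (p ^ b) ≤ Â * ((p : ℝ) ^ a) ^ (1 / 8 : ℝ) := by
      refine (hbG₂ b hb).trans (mul_le_mul_of_nonneg_left ?_ hÂ)
      exact Real.rpow_le_rpow hpb.le (pow_le_pow_right₀ hp1 hba) (by norm_num)
    -- `((p^a)^{1/8})² = (p^a)^{1/4}` and `(p^a)^{1/4} = ρ^a · p^a`
    have hsq : ((p : ℝ) ^ a) ^ (1 / 8 : ℝ) * ((p : ℝ) ^ a) ^ (1 / 8 : ℝ) =
        ((p : ℝ) ^ a) ^ (1 / 4 : ℝ) := by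
      rw [← Real.rpow_add hpa]; norm_num
    have hquarter : ((p : ℝ) ^ a) ^ (1 / 4 : ℝ) = ρ ^ a * (p : ℝ) ^ a := by
      rw [hρ, ← Shiu.rpow_pow_comm p a]
      have : ((p : ℝ) ^ a) ^ (1 / 4 : ℝ) = ((p : ℝ) ^ a) ^ (-(3 / 4 : ℝ) + 1) := by norm_num
      rw [this, Real.rpow_add hpa, Real.rpow_one]
    calc G₁ (p ^ a) * G₂ (p ^ b)
        ≤ (Â * ((p : ℝ) ^ a) ^ (1 / 8 : ℝ)) * (Â * ((p : ℝ) ^ a) ^ (1 / 8 : ℝ)) :=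
          mul_le_mul h1 h2 (hG₂ _) (by positivity)
      _ = Â ^ 2 * (((p : ℝ) ^ a) ^ (1 / 8 : ℝ) * ((p : ℝ) ^ a) ^ (1 / 8 : ℝ)) := by ring
      _ = Â ^ 2 * ρ ^ a * (p : ℝ) ^ a := by rw [hsq, hquarter]; ring
  by_cases hc : (a = 0 ↔ b = 0)
  · rw [if_pos hc]
    rcases Nat.eq_zero_or_pos a with ha0 | ha1
    · -- `a = b = 0`
      have hb0 : b = 0 := hc.mp ha0
      subst ha0; subst hb0
      rw [if_pos ⟨rfl, rfl⟩, if_neg (show ¬ ((0 : ℕ) = 1 ∧ (0 : ℕ) = 1) by omega),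
        if_neg (show ¬ (2 ≤ (0 : ℕ) ∧ (0 : ℕ) ≤ 0) by omega)]
      have hzero : F₁ (p ^ 0) * F₂ (p ^ 0) * (p : ℝ) ^ (min 0 0) / ((p : ℝ) ^ 0 * (p : ℝ) ^ 0) = 1 := by
        simp [h1₁, h1₂]
      rw [hzero]
      norm_num
    · have hb1 : 1 ≤ b := Nat.pos_of_ne_zero fun hb => by omega
      rw [if_neg (by omega : ¬ (a = 0 ∧ b = 0))]
      by_cases h11 : a = 1 ∧ b = 1
      · obtain ⟨rfl, rfl⟩ := h11
        rw [if_pos ⟨rfl, rfl⟩, if_neg (show ¬ (2 ≤ (1 : ℕ) ∧ (1 : ℕ) ≤ 1) by omega)]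
        have hval : F₁ (p ^ 1) * F₂ (p ^ 1) * (p : ℝ) ^ (min 1 1) / ((p : ℝ) ^ 1 * (p : ℝ) ^ 1) =
            F₁ p * F₂ p / p := by
          simp only [pow_one, min_self]
          field_simp
        rw [hval]
        norm_num
      · rw [if_neg h11]
        rcases le_or_gt b a with hba | hab
        · -- `b ≤ a`, so `a ≥ 2`
          have ha2 : 2 ≤ a := by
            by_contra h; push Not at h
            exact h11 ⟨by omega, by omega⟩
          rw [if_pos (show 2 ≤ a ∧ b ≤ a from ⟨ha2, hba⟩), mul_add]
          have := key h0₁ h0₂ hb₁ hb₂ a b hb1 hba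
          have hZ : 0 ≤ Â ^ 2 * (if 2 ≤ b ∧ a ≤ b then ρ ^ b else 0) := mul_nonneg (sq_nonneg Â) hR4
          linarith
        · -- `a < b`, so `b ≥ 2`
          have hb2 : 2 ≤ b := by omega
          rw [if_pos (show 2 ≤ b ∧ a ≤ b from ⟨hb2, hab.le⟩),
            if_neg (show ¬ (2 ≤ a ∧ b ≤ a) from fun h => by omega)]
          have := key h0₂ h0₁ hb₂ hb₁ b a ha1 hab.le
          rw [min_comm] at this
          have hcomm : F₁ (p ^ a) * F₂ (p ^ b) * (p : ℝ) ^ (min a b) / ((p : ℝ) ^ a * (p : ℝ) ^ b) =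
              F₂ (p ^ b) * F₁ (p ^ a) * (p : ℝ) ^ (min a b) / ((p : ℝ) ^ b * (p : ℝ) ^ a) := by
            ring
          rw [hcomm]
          simp only [zero_add]
          exact this
  · rw [if_neg hc]
    positivity

/-- **The local sum at a prime `p ∣ h`.** Summing `local_term_le` over `0 ≤ a, b ≤ A`:
`∑_{a,b} λ(a,b) ≤ 1 + F₁(p)F₂(p)/p + 80 Â²/(p√p)`, uniformly in `A`.
[cite: MatomakiMerikoski2023, Lemma 3.1 (the factor Δ_D)] -/
theorem local_sum_le {F₁ F₂ : ℕ → ℝ} (h0₁ : ∀ n, 0 ≤ F₁ n) (h0₂ : ∀ n, 0 ≤ F₂ n)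
    (h1₁ : F₁ 1 = 1) (h1₂ : F₂ 1 = 1) {Â : ℝ} (hÂ : 0 ≤ Â) {p : ℕ} (hp : p.Prime)
    (hb₁ : ∀ a : ℕ, 1 ≤ a → F₁ (p ^ a) ≤ Â * ((p : ℝ) ^ a) ^ (1 / 8 : ℝ))
    (hb₂ : ∀ a : ℕ, 1 ≤ a → F₂ (p ^ a) ≤ Â * ((p : ℝ) ^ a) ^ (1 / 8 : ℝ)) (A : ℕ) :
    ∑ j ∈ range (A + 1) ×ˢ range (A + 1), (if (j.1 = 0 ↔ j.2 = 0) then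
        F₁ (p ^ j.1) * F₂ (p ^ j.2) * (p : ℝ) ^ (min j.1 j.2) / ((p : ℝ) ^ j.1 * (p : ℝ) ^ j.2)
        else 0) ≤
      1 + F₁ p * F₂ p / p + 80 * Â ^ 2 / ((p : ℝ) * Real.sqrt p) := by
  obtain ⟨hρ0, hρ35, hρsq⟩ := rho_facts hp
  set ρ : ℝ := (p : ℝ) ^ (-(3 / 4 : ℝ)) with hρ
  set J := range (A + 1) ×ˢ range (A + 1) with hJ
  have hp0 : (0 : ℝ) < p := by exact_mod_cast hp.pos
  have hc0 : 0 ≤ F₁ p * F₂ p / p := by have := h0₁ p; have := h0₂ p; positivity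
  -- sum the pointwise bound
  have hpt := fun j : ℕ × ℕ => local_term_le h0₁ h0₂ h1₁ h1₂ hÂ hp hb₁ hb₂ j.1 j.2
  refine (Finset.sum_le_sum fun j _ => hpt j).trans ?_
  rw [Finset.sum_add_distrib, Finset.sum_add_distrib, ← Finset.mul_sum, Finset.sum_add_distrib]
  -- the four sums
  have hS1 : ∑ j ∈ J, (if j.1 = 0 ∧ j.2 = 0 then (1 : ℝ) else 0) = 1 := by
    have : ∀ j ∈ J, (if j.1 = 0 ∧ j.2 = 0 then (1 : ℝ) else 0) = if j = (0, 0) then 1 else 0 := by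
      intro j _
      have hiff : (j.1 = 0 ∧ j.2 = 0) ↔ j = (0, 0) := by rw [Prod.ext_iff]
      exact if_congr hiff rfl rfl
    rw [Finset.sum_congr rfl this, Finset.sum_ite_eq']
    rw [if_pos (by simp [hJ])]
  have hS2 : ∑ j ∈ J, (if j.1 = 1 ∧ j.2 = 1 then F₁ p * F₂ p / p else 0) ≤ F₁ p * F₂ p / p := by
    have : ∀ j ∈ J, (if j.1 = 1 ∧ j.2 = 1 then F₁ p * F₂ p / p else 0) =
        if j = (1, 1) then F₁ p * F₂ p / p else 0 := by
      intro j _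
      have hiff : (j.1 = 1 ∧ j.2 = 1) ↔ j = (1, 1) := by rw [Prod.ext_iff]
      exact if_congr hiff rfl rfl
    rw [Finset.sum_congr rfl this, Finset.sum_ite_eq']
    split_ifs
    · exact le_rfl
    · exact hc0
  -- the geometric parts
  have hinner : ∀ a : ℕ, ∑ b ∈ range (A + 1), (if 2 ≤ a ∧ b ≤ a then ρ ^ a else 0) ≤
      if 2 ≤ a then ((a : ℝ) + 1) * ρ ^ a else 0 := by
    intro a
    by_cases ha : 2 ≤ a
    · rw [if_pos ha]
      have : ∀ b ∈ range (A + 1), (if 2 ≤ a ∧ b ≤ a then ρ ^ a else 0) = if b ≤ a then ρ ^ a else 0 := by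
        intro b _
        by_cases hb : b ≤ a
        · rw [if_pos ⟨ha, hb⟩, if_pos hb]
        · rw [if_neg (fun h => hb h.2), if_neg hb]
      rw [Finset.sum_congr rfl this, ← Finset.sum_filter, Finset.sum_const, nsmul_eq_mul]
      refine mul_le_mul_of_nonneg_right ?_ (by positivity)
      have hsub : (range (A + 1)).filter (fun b => b ≤ a) ⊆ range (a + 1) := by
        intro b hb
        rw [Finset.mem_filter] at hb
        rw [Finset.mem_range]
        omega
      calc ((#((range (A + 1)).filter (fun b => b ≤ a)) : ℕ) : ℝ) ≤ #(range (a + 1)) := by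
            exact_mod_cast Finset.card_le_card hsub
        _ = (a : ℝ) + 1 := by rw [Finset.card_range]; push_cast; ring
    · rw [if_neg ha]
      refine (Finset.sum_eq_zero fun b _ => ?_).le
      rw [if_neg (fun h => ha h.1)]
  have hS3 : ∑ j ∈ J, (if 2 ≤ j.1 ∧ j.2 ≤ j.1 then ρ ^ j.1 else 0) ≤ 38 * ρ ^ 2 := by
    rw [hJ, Finset.sum_product]
    exact (Finset.sum_le_sum fun a _ => hinner a).trans (weighted_geom_sum_le hρ0.le hρ35 A)
  have hS4 : ∑ j ∈ J, (if 2 ≤ j.2 ∧ j.1 ≤ j.2 then ρ ^ j.2 else 0) ≤ 38 * ρ ^ 2 := by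
    rw [hJ, Finset.sum_product, Finset.sum_comm]
    exact (Finset.sum_le_sum fun a _ => hinner a).trans (weighted_geom_sum_le hρ0.le hρ35 A)
  rw [hS1]
  have h34 : Â ^ 2 * (∑ j ∈ J, (if 2 ≤ j.1 ∧ j.2 ≤ j.1 then ρ ^ j.1 else 0) +
      ∑ j ∈ J, (if 2 ≤ j.2 ∧ j.1 ≤ j.2 then ρ ^ j.2 else 0)) ≤ 80 * Â ^ 2 / ((p : ℝ) * Real.sqrt p) := by
    have h1 : Â ^ 2 * (∑ j ∈ J, (if 2 ≤ j.1 ∧ j.2 ≤ j.1 then ρ ^ j.1 else 0) +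
        ∑ j ∈ J, (if 2 ≤ j.2 ∧ j.1 ≤ j.2 then ρ ^ j.2 else 0)) ≤ Â ^ 2 * (76 * ρ ^ 2) :=
      mul_le_mul_of_nonneg_left (by linarith) (sq_nonneg Â)
    have h2 : Â ^ 2 * (76 * ρ ^ 2) ≤ 80 * Â ^ 2 / ((p : ℝ) * Real.sqrt p) := by
      rw [hρsq]
      have : Â ^ 2 * (76 * (1 / ((p : ℝ) * Real.sqrt p))) = 76 * Â ^ 2 / ((p : ℝ) * Real.sqrt p) := by
        ring
      rw [this]
      gcongr
      norm_num
    linarith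
  linarith


/-! ### Expanding multiplicative functions over a superset of the prime factors -/

/-- For `F` multiplicative on coprime arguments with `F 1 = 1`, `n ≠ 0` and `s ⊇ primeFactors n`:
`∏_{p ∈ s} F(p^{v_p(n)}) = F(n)`. [folklore] -/
theorem prod_factorization_superset {β : Type*} [CommMonoid β] {F : ℕ → β}
    (hmul : ∀ a b : ℕ, a.Coprime b → F (a * b) = F a * F b) (hF1 : F 1 = 1)
    {n : ℕ} (hn : n ≠ 0) {s : Finset ℕ} (hs : n.primeFactors ⊆ s) :
    ∏ p ∈ s, F (p ^ n.factorization p) = F n := by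
  rw [Nat.multiplicative_factorization F hmul hF1 hn, Finsupp.prod, Nat.support_factorization]
  symm
  refine Finset.prod_subset hs fun p _ hp => ?_
  rw [← Nat.support_factorization, Finsupp.notMem_support_iff] at hp
  rw [hp, pow_zero, hF1]

/-- `∏_{p ∈ s} p^{v_p(n)} = n` for `n ≠ 0` and `s ⊇ primeFactors n`. [folklore] -/
theorem prod_pow_factorization_superset {n : ℕ} (hn : n ≠ 0) {s : Finset ℕ}
    (hs : n.primeFactors ⊆ s) : ∏ p ∈ s, p ^ n.factorization p = n :=
  prod_factorization_superset (F := fun k : ℕ => k) (fun _ _ _ => rfl) rfl hn hs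

/-- `∏_{p ∈ s} p^{min(v_p a, v_p b)} = gcd(a, b)` for `a, b ≠ 0` with prime factors in `s`.
[folklore] -/
theorem prod_pow_min_factorization {a b : ℕ} (ha : a ≠ 0) (hb : b ≠ 0) {s : Finset ℕ}
    (hs : a.primeFactors ⊆ s) :
    ∏ p ∈ s, p ^ min (a.factorization p) (b.factorization p) = Nat.gcd a b := by
  have hg : Nat.gcd a b ≠ 0 := Nat.gcd_ne_zero_left ha
  have hsub : (Nat.gcd a b).primeFactors ⊆ s :=
    (Nat.primeFactors_mono (Nat.gcd_dvd_left a b) ha).trans hs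
  rw [← prod_pow_factorization_superset hg hsub]
  refine Finset.prod_congr rfl fun p _ => ?_
  rw [Nat.factorization_gcd ha hb, Finsupp.inf_apply]

/-! ### The bound for the `h`-part -/

/-- **The `h`-part of the bivariate sum** (Henriot's `Δ_D` in the shape needed here). Let
`F₁, F₂ ≥ 0` be multiplicative on coprime arguments with `Fᵢ(1) = 1` and
`Fᵢ(p^a) ≤ Â (p^a)^{1/8}` on prime powers. For any finite family of pairs `(e₁, e₂)` of positive
integers supported on the primes of `h ≠ 0` and coupled by `v_p(e₁) = 0 ↔ v_p(e₂) = 0` at every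
prime, `∑ F₁(e₁)F₂(e₂)(e₁,e₂)/(e₁e₂) ≤ e^{160 Â²} ∏_{p ∣ h} (1 + F₁(p)F₂(p)/p)`.
[cite: MatomakiMerikoski2023, Lemma 3.1 (the factor Δ_D)] -/
theorem sum_pairs_le {F₁ F₂ : ℕ → ℝ} (h0₁ : ∀ n, 0 ≤ F₁ n) (h0₂ : ∀ n, 0 ≤ F₂ n)
    (h1₁ : F₁ 1 = 1) (h1₂ : F₂ 1 = 1)
    (hm₁ : ∀ a b : ℕ, a.Coprime b → F₁ (a * b) = F₁ a * F₁ b)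
    (hm₂ : ∀ a b : ℕ, a.Coprime b → F₂ (a * b) = F₂ a * F₂ b)
    {Â : ℝ} (hÂ : 0 ≤ Â)
    (hb₁ : ∀ p a : ℕ, p.Prime → 1 ≤ a → F₁ (p ^ a) ≤ Â * ((p : ℝ) ^ a) ^ (1 / 8 : ℝ))
    (hb₂ : ∀ p a : ℕ, p.Prime → 1 ≤ a → F₂ (p ^ a) ≤ Â * ((p : ℝ) ^ a) ^ (1 / 8 : ℝ))
    (h : ℕ) (Pairs : Finset (ℕ × ℕ)) (hne : ∀ e ∈ Pairs, e.1 ≠ 0 ∧ e.2 ≠ 0)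
    (hsupp : ∀ e ∈ Pairs, e.1.primeFactors ⊆ h.primeFactors ∧ e.2.primeFactors ⊆ h.primeFactors)
    (hcouple : ∀ e ∈ Pairs, ∀ p : ℕ, e.1.factorization p = 0 ↔ e.2.factorization p = 0) :
    ∑ e ∈ Pairs, F₁ e.1 * F₂ e.2 * (Nat.gcd e.1 e.2 : ℝ) / ((e.1 : ℝ) * e.2) ≤
      Real.exp (160 * Â ^ 2) * ∏ p ∈ h.primeFactors, (1 + F₁ p * F₂ p / p) := by
  classical
  set s := h.primeFactors with hs
  have hsprime : ∀ p ∈ s, p.Prime := fun p hp => Nat.prime_of_mem_primeFactors hp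
  set A := Pairs.sup fun e => e.1 + e.2 with hA
  set J := range (A + 1) ×ˢ range (A + 1) with hJ
  set lam : ℕ → ℕ × ℕ → ℝ := fun p j => if (j.1 = 0 ↔ j.2 = 0) then
      F₁ (p ^ j.1) * F₂ (p ^ j.2) * (p : ℝ) ^ (min j.1 j.2) / ((p : ℝ) ^ j.1 * (p : ℝ) ^ j.2)
      else 0 with hlam
  set Φ : ℕ × ℕ → ℕ → ℕ × ℕ := fun e p => (e.1.factorization p, e.2.factorization p) with hΦ
  have hlam0 : ∀ p ∈ s, ∀ j ∈ J, 0 ≤ lam p j := by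
    intro p _ j _
    simp only [hlam]
    split_ifs
    · have := h0₁ (p ^ j.1); have := h0₂ (p ^ j.2); positivity
    · exact le_rfl
  -- Step 1: the two-variable Euler product
  have hstep1 : ∑ e ∈ Pairs, F₁ e.1 * F₂ e.2 * (Nat.gcd e.1 e.2 : ℝ) / ((e.1 : ℝ) * e.2) ≤
      ∏ p ∈ s, ∑ j ∈ J, lam p j := by
    refine sum_le_prod_sum_of_injOn s J lam hlam0 Pairs Φ ?_ ?_ _ ?_
    · -- local types are in `J`
      intro e he p _
      obtain ⟨he1, he2⟩ := hne e he
      have hle : e.1 + e.2 ≤ A := Finset.le_sup (f := fun e : ℕ × ℕ => e.1 + e.2) he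
      have h1 := Nat.factorization_lt p he1
      have h2 := Nat.factorization_lt p he2
      simp only [hΦ, hJ, Finset.mem_product, Finset.mem_range]
      omega
    · -- injectivity of the type map
      intro e he e' he' heq
      obtain ⟨he1, he2⟩ := hne e he
      obtain ⟨he1', he2'⟩ := hne e' he'
      have hval : ∀ p ∈ s, Φ e p = Φ e' p := fun p hp => by
        have := congrFun (congrFun heq p) hp
        exact this
      have hzero : ∀ (n : ℕ), n.primeFactors ⊆ s → ∀ p ∉ s, n.factorization p = 0 := by
        intro n hn p hp
        rw [← Finsupp.notMem_support_iff, Nat.support_factorization]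
        exact fun h' => hp (hn h')
      obtain ⟨hs1, hs2⟩ := hsupp e he
      obtain ⟨hs1', hs2'⟩ := hsupp e' he'
      have h1 : e.1 = e'.1 := by
        refine Nat.eq_of_factorization_eq he1 he1' fun p => ?_
        by_cases hp : p ∈ s
        · exact congrArg Prod.fst (hval p hp)
        · rw [hzero _ hs1 p hp, hzero _ hs1' p hp]
      have h2 : e.2 = e'.2 := by
        refine Nat.eq_of_factorization_eq he2 he2' fun p => ?_
        by_cases hp : p ∈ s
        · exact congrArg Prod.snd (hval p hp)
        · rw [hzero _ hs2 p hp, hzero _ hs2' p hp]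
      exact Prod.ext h1 h2
    · -- the weight is the product of the local weights
      intro e he
      obtain ⟨he1, he2⟩ := hne e he
      obtain ⟨hs1, hs2⟩ := hsupp e he
      have hloc : ∀ p ∈ s, lam p (Φ e p) = F₁ (p ^ e.1.factorization p) * F₂ (p ^ e.2.factorization p) *
          (p : ℝ) ^ (min (e.1.factorization p) (e.2.factorization p)) /
            ((p : ℝ) ^ e.1.factorization p * (p : ℝ) ^ e.2.factorization p) := by
        intro p _
        simp only [hlam, hΦ]
        rw [if_pos (hcouple e he p)]
      rw [Finset.prod_congr rfl hloc, Finset.prod_div_distrib, Finset.prod_mul_distrib,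
        Finset.prod_mul_distrib, Finset.prod_mul_distrib,
        prod_factorization_superset hm₁ h1₁ he1 hs1, prod_factorization_superset hm₂ h1₂ he2 hs2]
      congr 1
      · congr 1
        rw [← prod_pow_min_factorization he1 he2 hs1]
        push_cast
        rfl
      · have h1 : ∏ p ∈ s, (p : ℝ) ^ e.1.factorization p = (e.1 : ℝ) := by
          conv_rhs => rw [← prod_pow_factorization_superset he1 hs1]
          push_cast; rfl
        have h2 : ∏ p ∈ s, (p : ℝ) ^ e.2.factorization p = (e.2 : ℝ) := by
          conv_rhs => rw [← prod_pow_factorization_superset he2 hs2]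
          push_cast; rfl
        rw [h1, h2]
  -- Step 2: the local sums
  have hstep2 : ∏ p ∈ s, ∑ j ∈ J, lam p j ≤
      ∏ p ∈ s, ((1 + F₁ p * F₂ p / p) * (1 + 80 * Â ^ 2 / ((p : ℝ) * Real.sqrt p))) := by
    refine Finset.prod_le_prod (fun p hp => Finset.sum_nonneg fun j hj => hlam0 p hp j hj) fun p hp => ?_
    have hpp := hsprime p hp
    have hloc := local_sum_le h0₁ h0₂ h1₁ h1₂ hÂ hpp (fun a ha => hb₁ p a hpp ha)
      (fun a ha => hb₂ p a hpp ha) A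
    refine hloc.trans ?_
    have hu : 0 ≤ F₁ p * F₂ p / p := by have := h0₁ p; have := h0₂ p; positivity
    have ht : 0 ≤ 80 * Â ^ 2 / ((p : ℝ) * Real.sqrt p) := by positivity
    nlinarith
  -- Step 3: the tail product
  have hstep3 : ∏ p ∈ s, (1 + 80 * Â ^ 2 / ((p : ℝ) * Real.sqrt p)) ≤ Real.exp (160 * Â ^ 2) := by
    refine (prod_le_exp_sum s (fun p _ => by positivity) (fun p _ => le_rfl)).trans ?_
    rw [Real.exp_le_exp]
    have hsum := sum_inv_mul_sqrt_le_two s fun p hp => (hsprime p hp).two_le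
    calc ∑ p ∈ s, 80 * Â ^ 2 / ((p : ℝ) * Real.sqrt p)
        = 80 * Â ^ 2 * ∑ p ∈ s, 1 / ((p : ℝ) * Real.sqrt p) := by
          rw [Finset.mul_sum]
          refine Finset.sum_congr rfl fun p _ => ?_
          ring
      _ ≤ 80 * Â ^ 2 * 2 := by gcongr
      _ = 160 * Â ^ 2 := by ring
  have hmain0 : 0 ≤ ∏ p ∈ s, (1 + F₁ p * F₂ p / p) :=
    Finset.prod_nonneg fun p _ => by have := h0₁ p; have := h0₂ p; positivity
  calc ∑ e ∈ Pairs, F₁ e.1 * F₂ e.2 * (Nat.gcd e.1 e.2 : ℝ) / ((e.1 : ℝ) * e.2)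
      ≤ ∏ p ∈ s, ∑ j ∈ J, lam p j := hstep1
    _ ≤ ∏ p ∈ s, ((1 + F₁ p * F₂ p / p) * (1 + 80 * Â ^ 2 / ((p : ℝ) * Real.sqrt p))) := hstep2
    _ = (∏ p ∈ s, (1 + F₁ p * F₂ p / p)) * ∏ p ∈ s, (1 + 80 * Â ^ 2 / ((p : ℝ) * Real.sqrt p)) :=
        Finset.prod_mul_distrib
    _ ≤ (∏ p ∈ s, (1 + F₁ p * F₂ p / p)) * Real.exp (160 * Â ^ 2) :=
        mul_le_mul_of_nonneg_left hstep3 hmain0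
    _ = _ := by ring


/-! ### The correction factor `ψ(k) = ∏_{p ∣ k, p ≠ 2} (p−1)/(p−2)` -/

/-- Each factor `(p−1)/(p−2)`, `p` an odd prime, lies in `[1, 2]`. [folklore] -/
theorem psi_factor_bounds {p : ℕ} (hp : p.Prime) (hp2 : p ≠ 2) :
    1 ≤ ((p : ℝ) - 1) / ((p : ℝ) - 2) ∧ ((p : ℝ) - 1) / ((p : ℝ) - 2) ≤ 2 := by
  have hp3 : (3 : ℝ) ≤ p := by
    exact_mod_cast (Nat.succ_le_of_lt (lt_of_le_of_ne hp.two_le (Ne.symm hp2)))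
  have hden : 0 < (p : ℝ) - 2 := by linarith
  constructor
  · rw [le_div_iff₀ hden]; linarith
  · rw [div_le_iff₀ hden]; linarith

/-- `ψ(k) ≥ 1`. [folklore] -/
theorem one_le_psi (k : ℕ) :
    1 ≤ ∏ p ∈ k.primeFactors.erase 2, (((p : ℝ) - 1) / ((p : ℝ) - 2)) := by
  refine Finset.one_le_prod fun p hp => ?_
  rw [Finset.mem_erase] at hp
  exact (psi_factor_bounds (Nat.prime_of_mem_primeFactors hp.2) hp.1).1

/-- `ψ(k) ≥ 0`. [folklore] -/
theorem psi_nonneg (k : ℕ) :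
    0 ≤ ∏ p ∈ k.primeFactors.erase 2, (((p : ℝ) - 1) / ((p : ℝ) - 2)) :=
  zero_le_one.trans (one_le_psi k)

/-- Sub-multiplicativity: `ψ(ab) ≤ ψ(a) ψ(b)`. [folklore] -/
theorem psi_mul_le (a b : ℕ) :
    ∏ p ∈ (a * b).primeFactors.erase 2, (((p : ℝ) - 1) / ((p : ℝ) - 2)) ≤
      (∏ p ∈ a.primeFactors.erase 2, (((p : ℝ) - 1) / ((p : ℝ) - 2))) *
        ∏ p ∈ b.primeFactors.erase 2, (((p : ℝ) - 1) / ((p : ℝ) - 2)) := by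
  rcases Nat.eq_zero_or_pos a with rfl | ha
  · simp only [zero_mul, Nat.primeFactors_zero, Finset.erase_empty, Finset.prod_empty, one_mul]
    exact one_le_psi b
  rcases Nat.eq_zero_or_pos b with rfl | hb
  · simp only [mul_zero, Nat.primeFactors_zero, Finset.erase_empty, Finset.prod_empty, mul_one]
    exact one_le_psi a
  have hunion : (a * b).primeFactors.erase 2 = a.primeFactors.erase 2 ∪ b.primeFactors.erase 2 := by
    rw [Nat.primeFactors_mul ha.ne' hb.ne', Finset.erase_union_distrib]
  rw [hunion]
  have hge : ∀ p ∈ a.primeFactors.erase 2 ∪ b.primeFactors.erase 2,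
      1 ≤ ((p : ℝ) - 1) / ((p : ℝ) - 2) := by
    intro p hp
    rcases Finset.mem_union.mp hp with h | h <;>
    · rw [Finset.mem_erase] at h
      exact (psi_factor_bounds (Nat.prime_of_mem_primeFactors h.2) h.1).1
  rw [← Finset.prod_union_inter]
  refine le_mul_of_one_le_right (Finset.prod_nonneg fun p hp => zero_le_one.trans (hge p hp)) ?_
  exact Finset.one_le_prod fun p hp => hge p (Finset.mem_union_left _ (Finset.mem_inter.mp hp).1)

/-- Multiplicativity on coprime arguments: `ψ(ab) = ψ(a) ψ(b)` for `(a, b) = 1`. [folklore] -/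
theorem psi_mul_of_coprime {a b : ℕ} (hab : a.Coprime b) :
    ∏ p ∈ (a * b).primeFactors.erase 2, (((p : ℝ) - 1) / ((p : ℝ) - 2)) =
      (∏ p ∈ a.primeFactors.erase 2, (((p : ℝ) - 1) / ((p : ℝ) - 2))) *
        ∏ p ∈ b.primeFactors.erase 2, (((p : ℝ) - 1) / ((p : ℝ) - 2)) := by
  rw [hab.primeFactors_mul, Finset.erase_union_distrib]
  refine Finset.prod_union ?_
  exact (Finset.disjoint_of_subset_left (Finset.erase_subset _ _)
    (Finset.disjoint_of_subset_right (Finset.erase_subset _ _) hab.disjoint_primeFactors))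

/-- `ψ(p^l)` for a prime power: `1` at `p = 2` and `(p−1)/(p−2)` otherwise; in all cases `≤ 2`.
[folklore] -/
theorem psi_prime_pow_le_two {p : ℕ} (hp : p.Prime) (l : ℕ) :
    ∏ q ∈ (p ^ l).primeFactors.erase 2, (((q : ℝ) - 1) / ((q : ℝ) - 2)) ≤ 2 := by
  rcases Nat.eq_zero_or_pos l with rfl | hl
  · simp
  · rw [Nat.primeFactors_prime_pow hl.ne' hp]
    by_cases h2 : p = 2
    · subst h2; simp
    · rw [Finset.erase_eq_of_notMem (by simpa using Ne.symm h2), Finset.prod_singleton]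
      exact (psi_factor_bounds hp h2).2

/-- `ψ(1) = 1`. [folklore] -/
theorem psi_one : ∏ p ∈ (1 : ℕ).primeFactors.erase 2, (((p : ℝ) - 1) / ((p : ℝ) - 2)) = 1 := by
  simp

/-- The correction factor of the sieve main term is dominated by `ψ`: for `E ≠ 0` and a set `S`
of odd primes, `∏_{p ∈ S, p ∣ E} (p−1)/(p−2) ≤ ψ(E)`. [folklore] -/
theorem prod_filter_dvd_le_psi {S : Finset ℕ} (hS : ∀ p ∈ S, p.Prime ∧ p ≠ 2) {E : ℕ} (hE : E ≠ 0) :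
    ∏ p ∈ S.filter (· ∣ E), (((p : ℝ) - 1) / ((p : ℝ) - 2)) ≤
      ∏ p ∈ E.primeFactors.erase 2, (((p : ℝ) - 1) / ((p : ℝ) - 2)) := by
  have hsub : S.filter (· ∣ E) ⊆ E.primeFactors.erase 2 := by
    intro p hp
    rw [Finset.mem_filter] at hp
    obtain ⟨hpp, hp2⟩ := hS p hp.1
    exact Finset.mem_erase.mpr ⟨hp2, Nat.mem_primeFactors.mpr ⟨hpp, hp.2, hE⟩⟩
  refine Finset.prod_le_prod_of_subset_of_one_le hsub (fun p hp => ?_) fun p hp _ => ?_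
  · obtain ⟨hpp, hp2⟩ := hS p (Finset.mem_filter.mp hp).1
    exact zero_le_one.trans (psi_factor_bounds hpp hp2).1
  · rw [Finset.mem_erase] at hp
    exact (psi_factor_bounds (Nat.prime_of_mem_primeFactors hp.2) hp.1).1

/-- `ψ(abcd) ≤ ψ(a)ψ(b)ψ(c)ψ(d)`. [folklore] -/
theorem psi_mul_four_le (a b c d : ℕ) :
    ∏ p ∈ (a * b * c * d).primeFactors.erase 2, (((p : ℝ) - 1) / ((p : ℝ) - 2)) ≤
      (∏ p ∈ a.primeFactors.erase 2, (((p : ℝ) - 1) / ((p : ℝ) - 2))) *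
      (∏ p ∈ b.primeFactors.erase 2, (((p : ℝ) - 1) / ((p : ℝ) - 2))) *
      (∏ p ∈ c.primeFactors.erase 2, (((p : ℝ) - 1) / ((p : ℝ) - 2))) *
      ∏ p ∈ d.primeFactors.erase 2, (((p : ℝ) - 1) / ((p : ℝ) - 2)) := by
  calc _ ≤ (∏ p ∈ (a * b * c).primeFactors.erase 2, (((p : ℝ) - 1) / ((p : ℝ) - 2))) *
        ∏ p ∈ d.primeFactors.erase 2, (((p : ℝ) - 1) / ((p : ℝ) - 2)) := psi_mul_le _ _
    _ ≤ ((∏ p ∈ (a * b).primeFactors.erase 2, (((p : ℝ) - 1) / ((p : ℝ) - 2))) *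
        ∏ p ∈ c.primeFactors.erase 2, (((p : ℝ) - 1) / ((p : ℝ) - 2))) *
        ∏ p ∈ d.primeFactors.erase 2, (((p : ℝ) - 1) / ((p : ℝ) - 2)) :=
        mul_le_mul_of_nonneg_right (psi_mul_le _ _) (psi_nonneg d)
    _ ≤ _ := by
        refine mul_le_mul_of_nonneg_right (mul_le_mul_of_nonneg_right (psi_mul_le a b)
          (psi_nonneg c)) (psi_nonneg d)

end PairShiuLocal

end Literature.NumberTheory.Sieve
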